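import Mathlib
import HarnessLib
import Summits.HubbardSuperconductivity.HubbardSuperconductivity.Theorems.KLProgrammeKLRegimeEngineTowerProfiles

/-!
# Route `KLProgramme` — crux K3 ENGINE (stmt-HubbardSuperconductivity-20437 `KLRegimeEngineV17F2`), stub (b) v2, THE LEVELS PACKAGE (ℓ):
# (I1-dim), second brick — the first-order (binomial) doors' right side IS the kit's `towerFO` (E1-LEVELS-BLUEPRINT-g8 §9; E1 lead r2d-p2 g8)

The binomial plateau doors (`Literature/…/SectorisedIncrementBoundBinomial{Weighted,Prescribed}Plateau`, at the block geometry: `blockStep_firstOrder_{wt,lev}_le`) bound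
the first-order part of a block step in output degree `2(p+1)` by `cr·cc^{2p+1}·Σ_{m′ ≤ D_Γ} 𝟙[p+1 < m′]·C(2m′, 2(p+1))·κ^{2m′−2(p+1)}·N(m′)`; the kit's step hypothesis
reads `towerFO D σ μ (p+1) = Σ_{m′ ∈ (p+1, D]} C(2m′, 2(p+1))·σ^{m′−(p+1)}·μ(m′)` (…TowerProfiles).  Dictionary: **`σ := κ²`**, `μ := N`, any `D ≥ D_Γ`:

* **`doorBinomial_le_towerFO`** — the door's binomial sum `≤ towerFO D (κ²) N (p+1)` (equal when `D = D_Γ`).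
Pure real analysis; nothing about the model is asserted.
-/

noncomputable section

namespace Summit.HubbardSuperconductivity.HubbardSuperconductivity.Theorems.EngineV8

set_option linter.dupNamespace false -- summit = problem name (single-conjunct summit), D-0017

open Real Finset

/-- **THE BINOMIAL DOOR'S RIGHT SIDE IS DOMINATED BY `towerFO`** (`σ := κ²`): for `κ ≥ 0`, `N ≥ 0`, `D_Γ ≤ D`,
`Σ_{m′ < D_Γ+1} (if p+1 < m′ then C(2m′,2(p+1))·κ^{2m′−2(p+1)}·N m′ else 0) ≤ towerFO D (κ²) N (p+1)`. -/
theorem doorBinomial_le_towerFO {κ : ℝ} (hκ : 0 ≤ κ) {N : ℕ → ℝ} (hN0 : ∀ m, 0 ≤ N m) {DΓ D : ℕ} (hD : DΓ ≤ D) (p : ℕ) :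
    ∑ m' ∈ range (DΓ + 1), (if p + 1 < m' then ((2 * m').choose (2 * (p + 1)) : ℝ) * κ ^ (2 * m' - 2 * (p + 1)) * N m' else 0) ≤
      towerFO D (κ ^ 2) N (p + 1) := by
  rw [towerFO, ← sum_filter]
  have hsub : (range (DΓ + 1)).filter (fun m' => p + 1 < m') ⊆ Ioc (p + 1) D := by
    intro m' hm'
    rw [mem_filter, mem_range] at hm'
    rw [mem_Ioc]
    exact ⟨hm'.2, by omega⟩
  refine (sum_le_sum_of_subset_of_nonneg hsub fun m' _ _ => ?_).trans (le_of_eq (sum_congr rfl fun m' hm' => ?_))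
  · exact mul_nonneg (mul_nonneg (Nat.cast_nonneg _) (pow_nonneg hκ _)) (hN0 m')
  · have hlt : p + 1 < m' := (mem_Ioc.1 hm').1
    rw [← pow_mul, show 2 * (m' - (p + 1)) = 2 * m' - 2 * (p + 1) by omega]

end Summit.HubbardSuperconductivity.HubbardSuperconductivity.Theorems.EngineV8

end
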